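import Literature.AnabelianGeometry.AbsoluteAnabelian.AbsTopIII.CcnTransgressionSplitVanishing
import Literature.AnabelianGeometry.AbsoluteAnabelian.AbsTopIII.GeometricCyclotomeInnerProofs
import Literature.AnabelianGeometry.AbsoluteAnabelian.AbsTopIII.CuspidalSynchronizationHolds
import Literature.NumberTheory.GaloisRepresentations.ContinuousH2
import HarnessLib

/-!
# [AbsTopIII] Prop. 1.4 (ii), second half (`M_X ≅ I_x`), relative to a model: the universal closure of
# `CurveModel.Prop_1_4_ii_sync` over the INTERFACE is refuted; the instance form is the tree's reduction

Mochizuki, *Topics in Absolute Anabelian Geometry III*, §1, Prop. 1.4 (ii), manuscript pp. 31–32 (lit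
key `paper:url-5493eb38cbb7`): "`M_X := Hom(H²(Δ_X, Ẑ), Ẑ)` [...] this last element corresponds to the
natural isomorphism `M_X ⥲ I_x`".  PROOF-ONLY companion of `GeometricCyclotome.lean` (abc-iut cell,
block F fact-proving wave, seat abc-iut-f-082; FACT-LIST row **F-0365**
`AbsTopIII.CurveModel.Prop_1_4_ii_sync`); no definition, no statement file touched.

`CurveModel.Prop_1_4_ii_sync M` is a NAMED FACT RELATIVE TO A MODEL `M : CurveModel`: for every
cyclotome presentation `(U_x ⊆ X, x)` of `M` there is a `Π_{U_x}`-equivariant additive isomorphism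
between the intrinsic cyclotome `M_X = Hom(H²(Δ_X, Ẑ), Ẑ)` (`geomCyclotomeDual`) and the copy
`geomCyclotome (M.res h)` of `I_x` inside `Π_{U_x}/[N, Δ]⁻`.  The interface `CurveModel` carries no axiom
tying `M.ext U` to a curve ("nothing here asserts that a model exists", `CurveModel.lean`), so the
UNIVERSAL CLOSURE `∀ M, M.Prop_1_4_ii_sync` ranges over junk models — and is FALSE (FACT-LIST rule R5:
a schema row is consumable AT NAMED INSTANCES only).  This file records:

* `AbsTopIII.subsingleton_geomH2_of_geom_eq_bot` — **`H²(Δ_X, Λ) = 0` when `Δ_X = 1`**, for Mathlib's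
  continuous cohomology with trivial coefficients (`geomH2`): by the tree's inhomogeneous description
  of `H²_cont` (abc-iut's `ContinuousH2.lean`: `twoCocycleClass_surjective`, `twoCocycleClass_eq_zero_iff`)
  every class is the class of a continuous `2`-cocycle `f` of the trivial group, and `f` is the
  coboundary of the constant `1`-cochain `f(1,1)`;  hence
  `AbsTopIII.subsingleton_geomCyclotomeDual_of_geom_eq_bot` — **`M_X = Hom(H²(Δ_X, Λ), Λ) = 0`** then;
* `AbsTopIII.CurveModel.not_forall_prop_1_4_ii_sync` — **F-0365: the universal closure is REFUTED** at
  the two-curve junk model of seat abc-iut-f-076 (`CcnTransgressionSplitVanishing.lean`,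
  `CurveModel.not_forall_prop_1_4_ii_transgression`, adapted verbatim): over `ℚ`, `U_x ↦ (Ẑ × G ↠ G)`,
  `X ↦ (G = G)`, `G = Gal(ℚ̄/ℚ)`, `Ẑ` Mathlib's profinite completion of `ℤ`, `res` the second projection,
  one cusp of `U_x` with decomposition group `Π_{U_x}` — a cyclotome presentation with `I_x = Δ_{U_x} =
  Ẑ × 1`, `[N, Δ]⁻ = 1`, `Δ_X = 1`.  There `M_X = 0` (previous item) while `geomCyclotome ≅ I_x ≅ Ẑ` has
  an element `≠ 1`, so NO additive isomorphism `M_X ≃+ geomCyclotome` exists (the equivariance clause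
  is not even needed);
* `AbsTopIII.CurveModel.prop_1_4_ii_sync_schema_verdict` — the row's kernel status in one term: closure
  refuted ∧ the INSTANCE FORM the tree proves, seat abc-iut-L4-t1's reduction
  `CurveModel.prop_1_4_ii_sync_of_transgression : Prop_1_4_i' → Prop_1_4_ii_transgression →
  Prop_1_4_ii_sync` (`CuspidalSynchronizationHolds.lean`; i.e. F-0365 ⇐ F-0340 ∧ F-0338 at each model —
  themselves schema rows, `CurveModel.not_forall_prop_1_4_i'`, `CurveModel.not_forall_prop_1_4_ii_transgression`).

HONEST FRAMING: statements about the cell's own typing (junk instances of an interface), not about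
[AbsTopIII]; Prop. 1.4 (ii) itself is a refereed, undisputed result about étale fundamental groups of
hyperbolic curves (Leray differential / Poincaré duality for profinite surface groups), which the tree
does not construct; a FACT row is an assumption label, not an endorsement; nothing here bears on
[IUTchIII] Cor. 3.12 or takes a side; typed ≠ proved.
-/

noncomputable section

open CategoryTheory

namespace Literature.AnabelianGeometry.AbsoluteAnabelian.AbsTopIII

open FundamentalExtension Literature.NumberTheory.GaloisRepresentations

universe u

/-! ### `H²(1, Λ) = 0` and `Hom(H²(1, Λ), Λ) = 0` -/

/-- **`H²(Δ_X, Λ) = 0` for an extension with TRIVIAL geometric part `Δ_X = 1`** (Mathlib's continuous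
cohomology of the trivial `Δ_X`-module `Λ`, the tree's `geomH2`): every class is represented by a
continuous inhomogeneous `2`-cocycle `f` (`twoCocycleClass_surjective`), and on the trivial group `f` is
the coboundary `σ b(τ) - b(στ) + b(σ)` of the constant `1`-cochain `b ≡ f(1, 1)`
(`twoCocycleClass_eq_zero_iff`). [cite: SerreGaloisCohomology1997, I §2.3] -/
theorem subsingleton_geomH2_of_geom_eq_bot (F : FundamentalExtension.{u}) (hF : F.geom = ⊥)
    (Λ : Type u) [AddCommGroup Λ] [TopologicalSpace Λ] [IsTopologicalAddGroup Λ] :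
    Subsingleton (geomH2 F Λ) := by
  haveI := locallyCompactSpace_geom F
  have h1 : ∀ σ : F.geom, σ = 1 := fun σ =>
    Subtype.ext (Subgroup.mem_bot.mp (hF.le σ.2))
  have key : ∀ c : geomH2 F Λ, c = 0 := by
    intro c
    obtain ⟨f, rfl⟩ := twoCocycleClass_surjective (geomTrivialRep F Λ) c
    rw [twoCocycleClass_eq_zero_iff]
    refine ⟨ContinuousMap.const _ (f.1 (1, 1)), fun σ τ => ?_⟩
    obtain rfl := h1 σ
    obtain rfl := h1 τ
    simp only [map_one, ContinuousMap.const_apply, one_apply_eq_self, sub_add_cancel]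
  exact ⟨fun a b => by rw [key a, key b]⟩

/-- **`M_X(Λ) = Hom(H²(Δ_X, Λ), Λ) = 0` when `Δ_X = 1`** (the intrinsic cyclotome `geomCyclotomeDual`
of `GeometricCyclotome.lean` over an extension with trivial geometric part).
[cite: MochizukiAbsTopIII2015, Prop 1.4 (ii) p.31] -/
theorem subsingleton_geomCyclotomeDual_of_geom_eq_bot (F : FundamentalExtension.{u}) (hF : F.geom = ⊥)
    (Λ : Type u) [AddCommGroup Λ] [TopologicalSpace Λ] [IsTopologicalAddGroup Λ] :
    Subsingleton (geomCyclotomeDual F Λ) := by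
  haveI := subsingleton_geomH2_of_geom_eq_bot F hF Λ
  exact ⟨fun m m' => LinearMap.ext fun ξ => by rw [Subsingleton.elim ξ 0, map_zero, map_zero]⟩

namespace CurveModel

/-! ### F-0365: the universal closure of `Prop_1_4_ii_sync` is false -/

/-- **FACT-LIST F-0365 — the universal closure of `CurveModel.Prop_1_4_ii_sync` is FALSE.**  Witness:
seat abc-iut-f-076's junk instance of the interface (adapted verbatim from
`CurveModel.not_forall_prop_1_4_ii_transgression`): two curves over `ℚ`, `U_x ↦ (Π := Ẑ × G ↠ G)` and
`X ↦ (Π := G = G)`, `G = Gal(ℚ̄/ℚ)`, `Ẑ` Mathlib's profinite completion of `ℤ` (free procyclic,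
`isFreeProcyclic_zHatCompletion`), `res` the second projection, one cusp of `U_x` with decomposition
group `Π_{U_x}` — a cyclotome presentation with `I_x = Δ_{U_x} = Ẑ × 1`, `[N, Δ]⁻ = 1`, `Δ_X = 1`.  At it
`M_X = Hom(H²(1, Ẑ), Ẑ) = 0` (`subsingleton_geomCyclotomeDual_of_geom_eq_bot`) whereas
`geomCyclotome = I_x · 1/1 ≅ Ẑ` contains the class of `(z₀, 1)`, `z₀ ≠ 1`, so no additive isomorphism
`M_X ≃+ geomCyclotome` exists.  Hence F-0365 is consumable AT NAMED instances only; the printed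
Prop. 1.4 (ii) is not touched. [cite: MochizukiAbsTopIII2015, Prop 1.4 (ii) p.31] -/
theorem not_forall_prop_1_4_ii_sync :
    ¬ ∀ M : CurveModel.{0},
      Literature.AnabelianGeometry.AbsoluteAnabelian.AbsTopIII.CurveModel.Prop_1_4_ii_sync M := by
  intro hall
  -- adapted from AbsTopIII/CcnTransgressionSplitVanishing.lean (seat abc-iut-f-076): the junk model
  -- `Ẑ` (profinite completion of `ℤ`) and `G = G_ℚ`
  let ZH : ProfiniteGrp.{0} :=
    ProfiniteGrp.ProfiniteCompletion.completion (GrpCat.of (Multiplicative ℤ))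
  let Gp : ProfiniteGrp.{0} := absoluteGaloisGrp ℚ
  -- `Π_{U_x} := Ẑ × G ↠ G` and the point extension `Π_X := G`
  let E₁ : FundamentalExtension.{0} :=
    { arith := ProfiniteGrp.of (ZH × Gp), gal := Gp, aug := ContinuousMonoidHom.snd ZH Gp,
      aug_surjective := Prod.snd_surjective }
  let E₀ : FundamentalExtension.{0} :=
    { arith := Gp, gal := Gp, aug := ContinuousMonoidHom.id _,
      aug_surjective := Function.surjective_id }
  let qq : E₁ ⟶ E₀ := ⟨ContinuousMonoidHom.snd ZH Gp, ContinuousMonoidHom.id _, fun _ => rfl⟩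
  let rr : E₀ ⟶ E₁ := ⟨ContinuousMonoidHom.inr ZH Gp, ContinuousMonoidHom.id _, fun _ => rfl⟩
  -- one cusp on `U_x` with decomposition group `Π_{U_x}`; no cusps on `X`
  let C₁ : E₁.CuspidalData :=
    { Cusp := PUnit.{1}
      Dcusp := fun _ => ⊤
      Icusp := fun _ => ⊤ ⊓ E₁.geom
      Icusp_eq := fun _ => rfl
      isClosed_Dcusp := fun _ => by
        rw [Subgroup.coe_top]
        exact isClosed_univ
      eq_of_conj := fun a b _ _ => Subsingleton.elim a b }
  let C₀ : E₀.CuspidalData :=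
    { Cusp := PEmpty.{1}
      Dcusp := fun c => c.elim
      Icusp := fun c => c.elim
      Icusp_eq := fun c => c.elim
      isClosed_Dcusp := fun c => c.elim
      eq_of_conj := fun c => c.elim }
  -- the two-curve model: `false ↦ U_x`, `true ↦ X`
  let ext : ULift.{1, 0} Bool → FundamentalExtension.{0} :=
    fun U => Bool.rec (motive := fun _ => FundamentalExtension.{0}) E₁ E₀ U.down
  let M : CurveModel.{0} :=
    { Curve := ULift.{1, 0} Bool
      base := fun _ => ℚ
      ext := ext
      galIso := fun U =>
        Bool.rec (motive := fun b => ((ext ⟨b⟩).gal ≅ absoluteGaloisGrp ℚ)) (Iso.refl _) (Iso.refl _)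
          U.down
      cusps := fun U => Bool.rec (motive := fun b => (ext ⟨b⟩).CuspidalData) C₁ C₀ U.down
      IsProper := fun U => U.down = true
      IsScheme := fun _ => True
      genus := fun _ => 1
      FunctionField := fun _ => ℚ
      Point := fun _ => PEmpty.{1}
      decomp := fun _ c => c.elim
      IsNFCurve := fun _ => False
      IsNFPoint := fun _ c => c.elim
      IsNFRational := fun _ _ => False
      IsNFConstant := fun _ _ => False
      NFFunctionField := fun _ => ℚ
      IsStrictlyBelyiType := fun _ => False
      IsCofiniteOpen := fun _ _ => True
      res := fun {U U'} _ =>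
        Bool.rec (motive := fun b => (ext ⟨b⟩ ⟶ ext U'))
          (Bool.rec (motive := fun b' => (E₁ ⟶ ext ⟨b'⟩)) (𝟙 E₁) qq U'.down)
          (Bool.rec (motive := fun b' => (E₀ ⟶ ext ⟨b'⟩)) rr (𝟙 E₀) U'.down) U.down }
  -- `Δ_{U_x} = Ẑ × 1` is abelian: a dense cyclic subgroup of `Ẑ`
  obtain ⟨g, hg⟩ := isFreeProcyclic_zHatCompletion.exists_dense_zpowers
  have hcomm : ∀ a ∈ E₁.geom, ∀ b ∈ E₁.geom, a * b = b * a := by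
    intro a ha b hb
    have ha' : a.2 = 1 := ha
    have hb' : b.2 = 1 := hb
    exact Prod.ext (mul_comm_of_dense_zpowers hg a.1 b.1) (by
      change a.2 * b.2 = b.2 * a.2
      rw [ha', hb'])
  -- `N = Ker(q) ∩ Δ = Δ`
  have hker : cuspidalKernel qq = E₁.geom := by
    ext a
    change a ∈ qq.arith.toMonoidHom.ker ⊓ E₁.geom ↔ a ∈ E₁.geom
    rw [Subgroup.mem_inf, MonoidHom.mem_ker]
    exact ⟨fun h => h.2, fun h => ⟨h, h⟩⟩
  -- `[N, Δ]⁻ = 1`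
  have hmod : cuspidallyCentralModulus qq = ⊥ := by
    change (⁅cuspidalKernel qq, E₁.geom⁆).topologicalClosure = ⊥
    have hc : ⁅cuspidalKernel qq, E₁.geom⁆ = ⊥ := by
      rw [hker, Subgroup.commutator_eq_bot_iff_le_centralizer]
      intro a ha
      rw [Subgroup.mem_centralizer_iff]
      intro b hb
      exact hcomm b hb a ha
    rw [hc]
    refine le_antisymm (Subgroup.topologicalClosure_minimal ⊥ le_rfl ?_) bot_le
    rw [Subgroup.coe_bot]
    exact isClosed_singleton
  -- `I_x = Δ_{U_x}`
  have hI : (⊤ ⊓ E₁.geom : Subgroup E₁.arith) = E₁.geom := top_inf_eq E₁.geom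
  -- the cyclotome presentation
  have hp : M.IsCyclotomePresentation (Ux := ⟨false⟩) (X := ⟨true⟩) trivial PUnit.unit := by
    refine ⟨⟨trivial, trivial⟩, rfl, ?_, ?_, ?_, ?_⟩
    · -- `x` is rational: `D_x = Π ↠ G`
      intro γ _
      exact ⟨((1 : ZH), γ), Subgroup.mem_top _, rfl⟩
    · -- `I_x = Ẑ × 1 ≅ Ẑ` is free procyclic
      change FundamentalExtension.IsFreeProcyclic (⊤ ⊓ E₁.geom : Subgroup E₁.arith)
      rw [hI]
      refine isFreeProcyclic_zHatCompletion.of_continuousMulEquiv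
        { toFun := fun z => ⟨((z : ZH), (1 : Gp)), (rfl : (1 : Gp) = 1)⟩
          invFun := fun a => (a : E₁.arith).1
          left_inv := fun z => rfl
          right_inv := fun a => by
            apply Subtype.ext
            have ha : (a : E₁.arith).2 = 1 := a.2
            exact Prod.ext rfl ha.symm
          map_mul' := fun z w => rfl
          continuous_toFun := by
            apply Continuous.subtype_mk
            exact continuous_id.prodMk continuous_const
          continuous_invFun := continuous_fst.comp continuous_subtype_val }
    · -- `N = [I_x]⁻`: `N = Δ = I_x`, normal and closed
      change cuspidalKernel qq = (Subgroup.normalClosure ((⊤ ⊓ E₁.geom : Subgroup E₁.arith) :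
        Set E₁.arith)).topologicalClosure
      haveI : E₁.geom.Normal := E₁.normal_geom
      rw [hker, hI, Subgroup.normalClosure_eq_self]
      exact le_antisymm (Subgroup.le_topologicalClosure _)
        (Subgroup.topologicalClosure_minimal _ le_rfl E₁.isClosed_geom)
    · -- `1 → I_x → Δ^{c-cn} → Δ_X → 1` exact: `[N, Δ]⁻ = 1` and `I_x = N`
      change IsCuspidallyCentralExtension qq (⊤ ⊓ E₁.geom)
      refine ⟨?_, ?_⟩
      · rw [hmod, inf_bot_eq]
      · rw [hmod, sup_bot_eq, hI, hker]
  -- END of the adapted junk model.  The schema at this presentation: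
  obtain ⟨φ, -⟩ := hall M ⟨false⟩ ⟨true⟩ trivial PUnit.unit hp
  -- `M_X = Hom(H²(Δ_X, Ẑ), Ẑ)` is trivial since `Δ_X = 1`
  have hgeom₀ : E₀.geom = ⊥ := (MonoidHom.ker_eq_bot_iff _).mpr Function.injective_id
  have hsub : Subsingleton (geomCyclotomeDual E₀ ZHatCoeff.{0}) :=
    subsingleton_geomCyclotomeDual_of_geom_eq_bot E₀ hgeom₀ ZHatCoeff.{0}
  -- `Ẑ` is nontrivial (it has an open subgroup of index `2`)
  have hZ : ∃ z₀ : ZH, z₀ ≠ 1 := by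
    by_contra hz
    obtain ⟨H, -, hH⟩ := isFreeProcyclic_zHatCompletion.exists_isOpen_index 2 two_pos
    have hH' : H = ⊤ := by
      ext z
      have hz1 : z = 1 := of_not_not (not_exists.mp hz z)
      rw [hz1]
      exact ⟨fun _ => Subgroup.mem_top _, fun _ => H.one_mem⟩
    rw [hH', Subgroup.index_top] at hH
    exact absurd hH (by norm_num)
  obtain ⟨z₀, hz₀⟩ := hZ
  -- the class of `(z₀, 1) ∈ N = Δ_{U_x}` in `geomCyclotome q ⊆ Π_{U_x}/[N, Δ]⁻` is nontrivial
  have hmem : ((z₀, (1 : Gp)) : E₁.arith) ∈ cuspidalKernel qq := by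
    rw [hker]
    exact (rfl : (1 : Gp) = 1)
  haveI hN : (cuspidallyCentralModulus qq).Normal := cuspidallyCentralModulus_normal qq
  let a : geomCyclotome qq :=
    ⟨QuotientGroup.mk' (cuspidallyCentralModulus qq) ((z₀, (1 : Gp)) : E₁.arith),
      Subgroup.mem_map.mpr ⟨_, hmem, rfl⟩⟩
  have ha : a ≠ 1 := by
    intro h
    have h' : (QuotientGroup.mk' (cuspidallyCentralModulus qq) ((z₀, (1 : Gp)) : E₁.arith)) = 1 :=
      congrArg Subtype.val h
    rw [QuotientGroup.mk'_apply, QuotientGroup.eq_one_iff, hmod, Subgroup.mem_bot, Prod.mk_eq_one] at h'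
    exact hz₀ h'.1
  -- but `φ⁻¹` would inject `geomCyclotome q` into the trivial group `M_X`
  have hφ : φ.symm (Additive.ofMul a) = φ.symm (Additive.ofMul 1) :=
    @Subsingleton.elim _ hsub _ _
  exact ha (Additive.ofMul.injective (φ.symm.injective hφ))

/-- **F-0365 schema verdict** for the FACT-LIST fold: the universal closure of `Prop_1_4_ii_sync` is
refuted, AND the instance form the tree proves is seat abc-iut-L4-t1's reduction — at every model,
Prop. 1.4 (i) (`Prop_1_4_i'`, for the sections) and the natural form of Prop. 1.4 (ii)
(`Prop_1_4_ii_transgression`: the differential is bijective) imply the `∃`-shaped synchronization fact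
(`CurveModel.prop_1_4_ii_sync_of_transgression`, `CuspidalSynchronizationHolds.lean`).
[cite: MochizukiAbsTopIII2015, Prop 1.4 (ii) p.31] -/
theorem prop_1_4_ii_sync_schema_verdict :
    (¬ ∀ M : CurveModel.{0}, M.Prop_1_4_ii_sync) ∧
      ∀ M : CurveModel.{u}, M.Prop_1_4_i' → M.Prop_1_4_ii_transgression →
        Literature.AnabelianGeometry.AbsoluteAnabelian.AbsTopIII.CurveModel.Prop_1_4_ii_sync M :=
  ⟨not_forall_prop_1_4_ii_sync, fun M h14 hT => M.prop_1_4_ii_sync_of_transgression h14 hT⟩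

end CurveModel

end Literature.AnabelianGeometry.AbsoluteAnabelian.AbsTopIII

end
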